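import Summits.Ventures.PercRepro2.CaseOneEdgeSplit
import Summits.Ventures.PercRepro2.CaseOneThickeningRel

/-!
# An edge between the roots is invisible (blind cell PercRepro2, p1 g29; one more reduction rule)

Under `Q = {a₁ ↮ a₂}` every edge `e₀` joining `a₁` and `a₂` is closed, and with `e₀` closed the
connections are those of `G − e₀`: every mass of the case-1 forms at any statement vertex is
`(1 − p(e₀))` times the corresponding mass of `G − e₀` (`prob_inter_Q_rootEdge`, `Dpd_rootEdge`,
`Dpdo_rootEdge`, `Dqo_rootEdge`), so the forms of `G` are `(1 − p(e₀))³` times the forms of `G − e₀`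
(`iiExprT_rootEdge`, `iExprT_rootEdge`) and **`closedAt_of_root_edge`**: a statement vertex closed in
`G − e₀` is closed in `G`. Read downward: in a residual instance of the rung the roots are not
adjacent. Own code; standard axioms.
-/

namespace Summit.Ventures.PercRepro2

namespace CaseOne

section RootEdge
variable {V : Type*} {E : Type*} [Fintype E] [DecidableEq E] {R : Type*} [CommRing R]
variable {ends : E → Sym2 V} {o a₁ a₂ a₃ b : V} {e₀ : E}

omit [Fintype E] [DecidableEq E] in
/-- Under `Q` the root edge is closed. -/
lemma closed_of_rootEdge (he : ends e₀ = s(a₁, a₂)) {ω : Config E} (hQ : ¬ Conn ends ω a₁ a₂) :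
    ω e₀ = false := by
  by_contra h
  have h' : ω e₀ = true := by simpa using h
  exact hQ (conn_of_openAdj ⟨e₀, h', he⟩)

variable (p : E → R) (he : ends e₀ = s(a₁, a₂))
include he

/-- **Every mass under `Q` splits off the factor `1 − p(e₀)`**: for an event `X` of `G − e₀`,
`P(X ∩ Q) = (1 − p(e₀)) · P′(X ∩ Q′)`. -/
theorem prob_inter_Q_rootEdge (X : Set (Config {e : E // e ≠ e₀})) :
    prob p (restrictCfg e₀ ⁻¹' X ∩ (connEvent ends a₁ a₂)ᶜ) =
      (1 - p e₀) * prob (restrictW p e₀) (X ∩ (connEvent (restrictEnds ends e₀) a₁ a₂)ᶜ) := by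
  rw [prob_split_edge p e₀ _ (X ∩ (connEvent (restrictEnds ends e₀) a₁ a₂)ᶜ) ∅, prob_empty, mul_zero,
    add_zero]
  intro ω
  simp only [Set.mem_inter_iff, Set.mem_preimage, Set.mem_compl_iff, mem_connEvent,
    Set.mem_empty_iff_false, and_false, or_false]
  constructor
  · rintro ⟨hX, hQ⟩
    have h0 := closed_of_rootEdge he hQ
    exact ⟨h0, hX, fun h => hQ ((conn_restrict_iff_of_closed h0).2 h)⟩
  · rintro ⟨h0, hX, hQ⟩
    exact ⟨hX, fun h => hQ ((conn_restrict_iff_of_closed h0).1 h)⟩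

/-- `P(Q)` splits off the factor. -/
theorem probQ_rootEdge :
    prob p (connEvent ends a₁ a₂)ᶜ =
      (1 - p e₀) * prob (restrictW p e₀) (connEvent (restrictEnds ends e₀) a₁ a₂)ᶜ := by
  have := prob_inter_Q_rootEdge p he Set.univ
  rwa [Set.preimage_univ, Set.univ_inter, Set.univ_inter] at this

/-- A connection event of `G` is the preimage of the one of `G − e₀`, as far as `Q` is concerned:
`P(X ∩ Q)` for `X` a finite intersection of connection events. -/
theorem prob_connEvents_Q_rootEdge (x y : V) :
    prob p (connEvent ends x y ∩ (connEvent ends a₁ a₂)ᶜ) =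
      (1 - p e₀) * prob (restrictW p e₀) (connEvent (restrictEnds ends e₀) x y ∩
        (connEvent (restrictEnds ends e₀) a₁ a₂)ᶜ) := by
  rw [prob_split_edge p e₀ _ (connEvent (restrictEnds ends e₀) x y ∩
    (connEvent (restrictEnds ends e₀) a₁ a₂)ᶜ) ∅, prob_empty, mul_zero, add_zero]
  intro ω
  simp only [Set.mem_inter_iff, Set.mem_compl_iff, mem_connEvent, Set.mem_empty_iff_false,
    and_false, or_false]
  constructor
  · rintro ⟨hX, hQ⟩
    have h0 := closed_of_rootEdge he hQ
    exact ⟨h0, (conn_restrict_iff_of_closed h0).1 hX, fun h => hQ ((conn_restrict_iff_of_closed h0).2 h)⟩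
  · rintro ⟨h0, hX, hQ⟩
    exact ⟨(conn_restrict_iff_of_closed h0).2 hX, fun h => hQ ((conn_restrict_iff_of_closed h0).1 h)⟩

/-- Two connection events under `Q`: the factor splits off. -/
theorem prob_connEvents2_Q_rootEdge (x y u v : V) :
    prob p (connEvent ends x y ∩ connEvent ends u v ∩ (connEvent ends a₁ a₂)ᶜ) =
      (1 - p e₀) * prob (restrictW p e₀) (connEvent (restrictEnds ends e₀) x y ∩
        connEvent (restrictEnds ends e₀) u v ∩ (connEvent (restrictEnds ends e₀) a₁ a₂)ᶜ) := by
  rw [prob_split_edge p e₀ _ (connEvent (restrictEnds ends e₀) x y ∩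
    connEvent (restrictEnds ends e₀) u v ∩ (connEvent (restrictEnds ends e₀) a₁ a₂)ᶜ) ∅, prob_empty,
    mul_zero, add_zero]
  intro ω
  simp only [Set.mem_inter_iff, Set.mem_compl_iff, mem_connEvent, Set.mem_empty_iff_false,
    and_false, or_false]
  constructor
  · rintro ⟨⟨hX, hU⟩, hQ⟩
    have h0 := closed_of_rootEdge he hQ
    exact ⟨h0, ⟨(conn_restrict_iff_of_closed h0).1 hX, (conn_restrict_iff_of_closed h0).1 hU⟩,
      fun h => hQ ((conn_restrict_iff_of_closed h0).2 h)⟩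
  · rintro ⟨h0, ⟨hX, hU⟩, hQ⟩
    exact ⟨⟨(conn_restrict_iff_of_closed h0).2 hX, (conn_restrict_iff_of_closed h0).2 hU⟩,
      fun h => hQ ((conn_restrict_iff_of_closed h0).1 h)⟩

/-- Three connection events under `Q`: the factor splits off. -/
theorem prob_connEvents3_Q_rootEdge (x y u v s t : V) :
    prob p (connEvent ends x y ∩ connEvent ends u v ∩ connEvent ends s t ∩
      (connEvent ends a₁ a₂)ᶜ) =
      (1 - p e₀) * prob (restrictW p e₀) (connEvent (restrictEnds ends e₀) x y ∩
        connEvent (restrictEnds ends e₀) u v ∩ connEvent (restrictEnds ends e₀) s t ∩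
        (connEvent (restrictEnds ends e₀) a₁ a₂)ᶜ) := by
  rw [prob_split_edge p e₀ _ (connEvent (restrictEnds ends e₀) x y ∩
    connEvent (restrictEnds ends e₀) u v ∩ connEvent (restrictEnds ends e₀) s t ∩
    (connEvent (restrictEnds ends e₀) a₁ a₂)ᶜ) ∅, prob_empty, mul_zero, add_zero]
  intro ω
  simp only [Set.mem_inter_iff, Set.mem_compl_iff, mem_connEvent, Set.mem_empty_iff_false,
    and_false, or_false]
  constructor
  · rintro ⟨⟨⟨hX, hU⟩, hS⟩, hQ⟩
    have h0 := closed_of_rootEdge he hQ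
    exact ⟨h0, ⟨⟨(conn_restrict_iff_of_closed h0).1 hX, (conn_restrict_iff_of_closed h0).1 hU⟩,
      (conn_restrict_iff_of_closed h0).1 hS⟩, fun h => hQ ((conn_restrict_iff_of_closed h0).2 h)⟩
  · rintro ⟨h0, ⟨⟨hX, hU⟩, hS⟩, hQ⟩
    exact ⟨⟨⟨(conn_restrict_iff_of_closed h0).2 hX, (conn_restrict_iff_of_closed h0).2 hU⟩,
      (conn_restrict_iff_of_closed h0).2 hS⟩, fun h => hQ ((conn_restrict_iff_of_closed h0).1 h)⟩

/-- `D` splits off the factor. -/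
theorem Dpd_rootEdge :
    Dpd p ends a₁ a₂ a₃ = (1 - p e₀) * Dpd (restrictW p e₀) (restrictEnds ends e₀) a₁ a₂ a₃ := by
  unfold Dpd
  rw [prob_split_edge p e₀ _ ((connEvent (restrictEnds ends e₀) a₁ a₃)ᶜ ∩
    (connEvent (restrictEnds ends e₀) a₂ a₃)ᶜ ∩ (connEvent (restrictEnds ends e₀) a₁ a₂)ᶜ) ∅,
    prob_empty, mul_zero, add_zero]
  intro ω
  simp only [Set.mem_inter_iff, Set.mem_compl_iff, mem_connEvent, Set.mem_empty_iff_false,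
    and_false, or_false]
  constructor
  · rintro ⟨⟨h1, h2⟩, hQ⟩
    have h0 := closed_of_rootEdge he hQ
    exact ⟨h0, ⟨fun h => h1 ((conn_restrict_iff_of_closed h0).2 h),
      fun h => h2 ((conn_restrict_iff_of_closed h0).2 h)⟩,
      fun h => hQ ((conn_restrict_iff_of_closed h0).2 h)⟩
  · rintro ⟨h0, ⟨h1, h2⟩, hQ⟩
    exact ⟨⟨fun h => h1 ((conn_restrict_iff_of_closed h0).1 h),
      fun h => h2 ((conn_restrict_iff_of_closed h0).1 h)⟩,
      fun h => hQ ((conn_restrict_iff_of_closed h0).1 h)⟩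

/-- `D_o` splits off the factor. -/
theorem Dpdo_rootEdge :
    Dpdo p ends o a₁ a₂ a₃ = (1 - p e₀) * Dpdo (restrictW p e₀) (restrictEnds ends e₀) o a₁ a₂ a₃ := by
  unfold Dpdo
  rw [prob_split_edge p e₀ _ ((connEvent (restrictEnds ends e₀) a₁ o ∪
    connEvent (restrictEnds ends e₀) a₂ o) ∩ (connEvent (restrictEnds ends e₀) a₁ a₃)ᶜ ∩
    (connEvent (restrictEnds ends e₀) a₂ a₃)ᶜ ∩ (connEvent (restrictEnds ends e₀) a₁ a₂)ᶜ) ∅,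
    prob_empty, mul_zero, add_zero]
  intro ω
  simp only [Set.mem_inter_iff, Set.mem_union, Set.mem_compl_iff, mem_connEvent,
    Set.mem_empty_iff_false, and_false, or_false]
  constructor
  · rintro ⟨⟨⟨hU, h1⟩, h2⟩, hQ⟩
    have h0 := closed_of_rootEdge he hQ
    exact ⟨h0, ⟨⟨hU.imp (conn_restrict_iff_of_closed h0).1 (conn_restrict_iff_of_closed h0).1,
      fun h => h1 ((conn_restrict_iff_of_closed h0).2 h)⟩,
      fun h => h2 ((conn_restrict_iff_of_closed h0).2 h)⟩,
      fun h => hQ ((conn_restrict_iff_of_closed h0).2 h)⟩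
  · rintro ⟨h0, ⟨⟨hU, h1⟩, h2⟩, hQ⟩
    exact ⟨⟨⟨hU.imp (conn_restrict_iff_of_closed h0).2 (conn_restrict_iff_of_closed h0).2,
      fun h => h1 ((conn_restrict_iff_of_closed h0).1 h)⟩,
      fun h => h2 ((conn_restrict_iff_of_closed h0).1 h)⟩,
      fun h => hQ ((conn_restrict_iff_of_closed h0).1 h)⟩

/-- `P(Q, o ∈ U)` splits off the factor. -/
theorem Dqo_rootEdge :
    Dqo p ends o a₁ a₂ = (1 - p e₀) * Dqo (restrictW p e₀) (restrictEnds ends e₀) o a₁ a₂ := by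
  unfold Dqo
  rw [prob_split_edge p e₀ _ ((connEvent (restrictEnds ends e₀) a₁ o ∪
    connEvent (restrictEnds ends e₀) a₂ o) ∩ (connEvent (restrictEnds ends e₀) a₁ a₂)ᶜ) ∅,
    prob_empty, mul_zero, add_zero]
  intro ω
  simp only [Set.mem_inter_iff, Set.mem_union, Set.mem_compl_iff, mem_connEvent,
    Set.mem_empty_iff_false, and_false, or_false]
  constructor
  · rintro ⟨hU, hQ⟩
    have h0 := closed_of_rootEdge he hQ
    exact ⟨h0, hU.imp (conn_restrict_iff_of_closed h0).1 (conn_restrict_iff_of_closed h0).1,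
      fun h => hQ ((conn_restrict_iff_of_closed h0).2 h)⟩
  · rintro ⟨h0, hU, hQ⟩
    exact ⟨hU.imp (conn_restrict_iff_of_closed h0).2 (conn_restrict_iff_of_closed h0).2,
      fun h => hQ ((conn_restrict_iff_of_closed h0).1 h)⟩

/-- **The `(ii)` form of `G` is `(1 − p(e₀))³` times the `(ii)` form of `G − e₀`** (the pair scaled
by `1 − p(e₀)`). -/
theorem iiExprT_rootEdge (c₀ c₁ : R) :
    iiExprT p ends o a₁ a₂ a₃ b ((1 - p e₀) * c₀) ((1 - p e₀) * c₁) =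
      (1 - p e₀) ^ 3 * iiExprT (restrictW p e₀) (restrictEnds ends e₀) o a₁ a₂ a₃ b c₀ c₁ := by
  rw [iiExprT_eq, iiExprT_eq, probQ_rootEdge p he, prob_connEvents3_Q_rootEdge p he,
    prob_connEvents_Q_rootEdge p he, prob_connEvents2_Q_rootEdge p he,
    prob_connEvents2_Q_rootEdge p he, prob_connEvents_Q_rootEdge p he]
  ring

/-- **The `(i)` form of `G` is `(1 − p(e₀))³` times the `(i)` form of `G − e₀`.** -/
theorem iExprT_rootEdge (c₀ c₁ : R) :
    iExprT p ends o a₁ a₂ a₃ b ((1 - p e₀) * c₀) ((1 - p e₀) * c₁) =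
      (1 - p e₀) ^ 3 * iExprT (restrictW p e₀) (restrictEnds ends e₀) o a₁ a₂ a₃ b c₀ c₁ := by
  rw [iExprT_eq, iExprT_eq, probQ_rootEdge p he, prob_connEvents3_Q_rootEdge p he,
    prob_connEvents_Q_rootEdge p he, prob_connEvents2_Q_rootEdge p he,
    prob_connEvents2_Q_rootEdge p he, prob_connEvents_Q_rootEdge p he]
  ring

end RootEdge

section Closed
universe u
variable {V : Type*} {R : Type*} [CommRing R] [LinearOrder R] [IsStrictOrderedRing R]
  {E : Type u} [Fintype E] [DecidableEq E] {ends : E → Sym2 V} {o a₁ a₂ a₃ b : V} {e₀ : E}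

/-- **An edge between the roots is invisible**: a statement vertex closed in `G − e₀` is closed in
`G`. -/
theorem closedAt_of_root_edge (he : ends e₀ = s(a₁, a₂))
    (hc : ClosedAt R o a₁ a₂ b {e : E // e ≠ e₀} (restrictEnds ends e₀) a₃) :
    ClosedAt R o a₁ a₂ b E ends a₃ := by
  intro p hp
  obtain ⟨hii, hiiq, hi, hiq⟩ := hc (restrictW p e₀) (IsProbVec.restrictW hp e₀)
  have hq : 0 ≤ (1 - p e₀) ^ 3 := pow_nonneg (sub_nonneg.2 (hp.le_one e₀)) 3
  refine ⟨?_, ?_, ?_, ?_⟩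
  · rw [ZSplitII, iiExpr_eq_iiExprT, Dpdo_rootEdge p he, Dpd_rootEdge p he, iiExprT_rootEdge p he]
    rw [ZSplitII, iiExpr_eq_iiExprT] at hii
    exact mul_nonneg hq hii
  · rw [ZSplitIIQ, Dqo_rootEdge p he, probQ_rootEdge p he, iiExprT_rootEdge p he]
    exact mul_nonneg hq hiiq
  · rw [ZSplitI, iExpr_eq_iExprT, Dpdo_rootEdge p he, Dpd_rootEdge p he, iExprT_rootEdge p he]
    rw [ZSplitI, iExpr_eq_iExprT] at hi
    exact mul_nonneg hq hi
  · rw [ZSplitIQ, Dqo_rootEdge p he, probQ_rootEdge p he, iExprT_rootEdge p he]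
    exact mul_nonneg hq hiq

end Closed

end CaseOne

end Summit.Ventures.PercRepro2
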